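import Mathlib
import Summits.KontsevichZagierPeriods.Zeta5Search.RecordCellAtlas
import HarnessLib

/-!
# ζ(5) search — first-digit atlas cells of NEAR-MISSES rows 2 and 3, typed (gen-2 g9 statement file, part 1 of 2)
HONEST FRAMING: systematic search; no irrationality claim unless certified.

Companion of `RecordAtlasCells.lean` (record ray).  Rays: NEAR-MISSES row 2 = `bFam 12 n = n·(44;18,…,12)`, row 3 = `bFam 14 n = n·(50;20,…,14)`;
direction `e₇`, `θ = p/n`.  Each cell is a maximal θ-interval on which gen-2 g9's STRUCTURAL FIRST-DIGIT ATLAS (`HOME/pub-zeta5-gen-2/g9/rayatlas.py`,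
all `n` at once; cells extracted by `g9/atlas_cells.py`, logs `g9/atlas_cells_Row2.log`, `…_Row3.log`) certifies `v_p(Cas₇) ≥ B` with `B = casLB + 1`
(origin / affine cells) or `casLB + 2` (zero cells), `casLB` = THEOREM LB — paper-proved for all `n` modulo the in-tree digit theorems (REPORT-gen2-g9
§6.2, §9, §10).  The bound is the minimum over the two parities of `b₀` where they differ; an endpoint is included when the neighbouring face still
certifies `≥ B`.  Hypothesis `β₀·n + 2 < p·p` is the window of the tree's class theory (vacuous here for n ≥ 2, kept for uniformity with part 2).
Exact instances (gen-1 arithmetic, raycrit TSVs: row 2 n ≤ 6, row 3 n ≤ 4): 0 violations in 62 + 34 instances.  Prover aid: deep fine types with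
minimal realisation sets per cell in `HOME/pub-zeta5-gen-2/g9/cell_tables_row2_t12.md`, `…_row3_t14.md`.  Cells Row2CellK/L, Row3CellM/N coincide with
`CellAtlas.FamilyCellB/A` at t = 12, 14 and Row2CellI / Row3CellH,J with the tier cells of `FamilyTiers.lean`; they are listed for completeness of the atlas.
Part 2 (`RayAtlasCellsX.lean`) treats the rays X1, X2, X3.
-/

namespace Summit.KontsevichZagierPeriods.Zeta5Search.RayAtlas

open Summit.KontsevichZagierPeriods.Zeta5Search.CasoratianValuation (casoratian)
open Summit.KontsevichZagierPeriods.Zeta5Search.CellAtlas (bFam)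

/-! ## Row 2: `bFam 12 n` (θ-cells in (4, 16]) -/

/-- **Row2CellA** (`θ = p/n ∈ (17/4, 13/3]`, origin, casLB -25): `v_p(Cas₇) ≥ -24`; 1 exact instances, 0 violations. -/
@[conjecture] def Row2CellA : Prop :=
  ∀ n p : ℕ, 2 ≤ n → p.Prime → 44 * n + 2 < p * p → 17 * n < 4 * p → 3 * p ≤ 13 * n → casoratian (bFam 12 n) 7 ≠ 0 →
    (-24 : ℤ) ≤ padicValRat p (casoratian (bFam 12 n) 7)

/-- **Row2CellB** (`θ = p/n ∈ [22/5, 9/2]`, zero, casLB -25): `v_p(Cas₇) ≥ -23`; 0 exact instances, 0 violations. -/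
@[conjecture] def Row2CellB : Prop :=
  ∀ n p : ℕ, 2 ≤ n → p.Prime → 44 * n + 2 < p * p → 22 * n ≤ 5 * p → 2 * p ≤ 9 * n → casoratian (bFam 12 n) 7 ≠ 0 →
    (-23 : ℤ) ≤ padicValRat p (casoratian (bFam 12 n) 7)

/-- **Row2CellC** (`θ = p/n ∈ (5, 16/3]`, origin, casLB -21): `v_p(Cas₇) ≥ -20`; 1 exact instances, 0 violations. -/
@[conjecture] def Row2CellC : Prop :=
  ∀ n p : ℕ, 2 ≤ n → p.Prime → 44 * n + 2 < p * p → 5 * n < p → 3 * p ≤ 16 * n → casoratian (bFam 12 n) 7 ≠ 0 →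
    (-20 : ℤ) ≤ padicValRat p (casoratian (bFam 12 n) 7)

/-- **Row2CellD** (`θ = p/n ∈ (16/3, 27/5]`, affine, casLB -19): `v_p(Cas₇) ≥ -18`; 0 exact instances, 0 violations. -/
@[conjecture] def Row2CellD : Prop :=
  ∀ n p : ℕ, 2 ≤ n → p.Prime → 44 * n + 2 < p * p → 16 * n < 3 * p → 5 * p ≤ 27 * n → casoratian (bFam 12 n) 7 ≠ 0 →
    (-18 : ℤ) ≤ padicValRat p (casoratian (bFam 12 n) 7)

/-- **Row2CellE** (`θ = p/n ∈ (11/2, 17/3]`, origin, casLB -19): `v_p(Cas₇) ≥ -18`; 1 exact instances, 0 violations. -/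
@[conjecture] def Row2CellE : Prop :=
  ∀ n p : ℕ, 2 ≤ n → p.Prime → 44 * n + 2 < p * p → 11 * n < 2 * p → 3 * p ≤ 17 * n → casoratian (bFam 12 n) 7 ≠ 0 →
    (-18 : ℤ) ≤ padicValRat p (casoratian (bFam 12 n) 7)

/-- **Row2CellF** (`θ = p/n ∈ (6, 19/3]`, origin, casLB -17): `v_p(Cas₇) ≥ -16`; 3 exact instances, 0 violations. -/
@[conjecture] def Row2CellF : Prop :=
  ∀ n p : ℕ, 2 ≤ n → p.Prime → 44 * n + 2 < p * p → 6 * n < p → 3 * p ≤ 19 * n → casoratian (bFam 12 n) 7 ≠ 0 →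
    (-16 : ℤ) ≤ padicValRat p (casoratian (bFam 12 n) 7)

/-- **Row2CellG** (`θ = p/n ∈ (19/3, 20/3]`, zero, casLB -17): `v_p(Cas₇) ≥ -15`; 1 exact instances, 0 violations. -/
@[conjecture] def Row2CellG : Prop :=
  ∀ n p : ℕ, 2 ≤ n → p.Prime → 44 * n + 2 < p * p → 19 * n < 3 * p → 3 * p ≤ 20 * n → casoratian (bFam 12 n) 7 ≠ 0 →
    (-15 : ℤ) ≤ padicValRat p (casoratian (bFam 12 n) 7)

/-- **Row2CellH** (`θ = p/n ∈ (20/3, 27/4]`, affine, casLB -15): `v_p(Cas₇) ≥ -14`; 0 exact instances, 0 violations. -/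
@[conjecture] def Row2CellH : Prop :=
  ∀ n p : ℕ, 2 ≤ n → p.Prime → 44 * n + 2 < p * p → 20 * n < 3 * p → 4 * p ≤ 27 * n → casoratian (bFam 12 n) 7 ≠ 0 →
    (-14 : ℤ) ≤ padicValRat p (casoratian (bFam 12 n) 7)

/-- **Row2CellI** (`θ = p/n ∈ (15/2, 8]`, origin, casLB -13): `v_p(Cas₇) ≥ -12`; 3 exact instances, 0 violations. -/
@[conjecture] def Row2CellI : Prop :=
  ∀ n p : ℕ, 2 ≤ n → p.Prime → 44 * n + 2 < p * p → 15 * n < 2 * p → p ≤ 8 * n → casoratian (bFam 12 n) 7 ≠ 0 →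
    (-12 : ℤ) ≤ padicValRat p (casoratian (bFam 12 n) 7)

/-- **Row2CellJ** (`θ = p/n ∈ [17/2, 10]`, origin, casLB -13): `v_p(Cas₇) ≥ -12`; 8 exact instances, 0 violations. -/
@[conjecture] def Row2CellJ : Prop :=
  ∀ n p : ℕ, 2 ≤ n → p.Prime → 44 * n + 2 < p * p → 17 * n ≤ 2 * p → p ≤ 10 * n → casoratian (bFam 12 n) 7 ≠ 0 →
    (-12 : ℤ) ≤ padicValRat p (casoratian (bFam 12 n) 7)

/-- **Row2CellK** (`θ = p/n ∈ (13, 27/2]`, affine, casLB -7): `v_p(Cas₇) ≥ -6`; 3 exact instances, 0 violations. -/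
@[conjecture] def Row2CellK : Prop :=
  ∀ n p : ℕ, 2 ≤ n → p.Prime → 44 * n + 2 < p * p → 13 * n < p → 2 * p ≤ 27 * n → casoratian (bFam 12 n) 7 ≠ 0 →
    (-6 : ℤ) ≤ padicValRat p (casoratian (bFam 12 n) 7)

/-- **Row2CellL** (`θ = p/n ∈ (15, 16]`, origin, casLB -5): `v_p(Cas₇) ≥ -4`; 4 exact instances, 0 violations. -/
@[conjecture] def Row2CellL : Prop :=
  ∀ n p : ℕ, 2 ≤ n → p.Prime → 44 * n + 2 < p * p → 15 * n < p → p ≤ 16 * n → casoratian (bFam 12 n) 7 ≠ 0 →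
    (-4 : ℤ) ≤ padicValRat p (casoratian (bFam 12 n) 7)

/-! ## Row 3: `bFam 14 n` (θ-cells in (4, 18]) -/

/-- **Row3CellA** (`θ = p/n ∈ (9/2, 14/3]`, origin, casLB -27): `v_p(Cas₇) ≥ -26`; 0 exact instances, 0 violations. -/
@[conjecture] def Row3CellA : Prop :=
  ∀ n p : ℕ, 2 ≤ n → p.Prime → 50 * n + 2 < p * p → 9 * n < 2 * p → 3 * p ≤ 14 * n → casoratian (bFam 14 n) 7 ≠ 0 →
    (-26 : ℤ) ≤ padicValRat p (casoratian (bFam 14 n) 7)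

/-- **Row3CellB** (`θ = p/n ∈ (19/4, 21/4]`, origin, casLB -25): `v_p(Cas₇) ≥ -24`; 0 exact instances, 0 violations. -/
@[conjecture] def Row3CellB : Prop :=
  ∀ n p : ℕ, 2 ≤ n → p.Prime → 50 * n + 2 < p * p → 19 * n < 4 * p → 4 * p ≤ 21 * n → casoratian (bFam 14 n) 7 ≠ 0 →
    (-24 : ℤ) ≤ padicValRat p (casoratian (bFam 14 n) 7)

/-- **Row3CellC** (`θ = p/n ∈ (17/3, 6]`, origin, casLB -21): `v_p(Cas₇) ≥ -20`; 1 exact instances, 0 violations. -/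
@[conjecture] def Row3CellC : Prop :=
  ∀ n p : ℕ, 2 ≤ n → p.Prime → 50 * n + 2 < p * p → 17 * n < 3 * p → p ≤ 6 * n → casoratian (bFam 14 n) 7 ≠ 0 →
    (-20 : ℤ) ≤ padicValRat p (casoratian (bFam 14 n) 7)

/-- **Row3CellD** (`θ = p/n ∈ (6, 31/5]`, affine, casLB -19): `v_p(Cas₇) ≥ -18`; 0 exact instances, 0 violations. -/
@[conjecture] def Row3CellD : Prop :=
  ∀ n p : ℕ, 2 ≤ n → p.Prime → 50 * n + 2 < p * p → 6 * n < p → 5 * p ≤ 31 * n → casoratian (bFam 14 n) 7 ≠ 0 →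
    (-18 : ℤ) ≤ padicValRat p (casoratian (bFam 14 n) 7)

/-- **Row3CellE** (`θ = p/n ∈ (19/3, 13/2]`, origin, casLB -19): `v_p(Cas₇) ≥ -18`; 1 exact instances, 0 violations. -/
@[conjecture] def Row3CellE : Prop :=
  ∀ n p : ℕ, 2 ≤ n → p.Prime → 50 * n + 2 < p * p → 19 * n < 3 * p → 2 * p ≤ 13 * n → casoratian (bFam 14 n) 7 ≠ 0 →
    (-18 : ℤ) ≤ padicValRat p (casoratian (bFam 14 n) 7)

/-- **Row3CellF** (`θ = p/n ∈ [50/7, 22/3]`, zero, casLB -17): `v_p(Cas₇) ≥ -15`; 1 exact instances, 0 violations. -/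
@[conjecture] def Row3CellF : Prop :=
  ∀ n p : ℕ, 2 ≤ n → p.Prime → 50 * n + 2 < p * p → 50 * n ≤ 7 * p → 3 * p ≤ 22 * n → casoratian (bFam 14 n) 7 ≠ 0 →
    (-15 : ℤ) ≤ padicValRat p (casoratian (bFam 14 n) 7)

/-- **Row3CellG** (`θ = p/n ∈ (15/2, 31/4]`, affine, casLB -15): `v_p(Cas₇) ≥ -14`; 2 exact instances, 0 violations. -/
@[conjecture] def Row3CellG : Prop :=
  ∀ n p : ℕ, 2 ≤ n → p.Prime → 50 * n + 2 < p * p → 15 * n < 2 * p → 4 * p ≤ 31 * n → casoratian (bFam 14 n) 7 ≠ 0 →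
    (-14 : ℤ) ≤ padicValRat p (casoratian (bFam 14 n) 7)

/-- **Row3CellH** (`θ = p/n ∈ (17/2, 9]`, origin, casLB -13): `v_p(Cas₇) ≥ -12`; 0 exact instances, 0 violations. -/
@[conjecture] def Row3CellH : Prop :=
  ∀ n p : ℕ, 2 ≤ n → p.Prime → 50 * n + 2 < p * p → 17 * n < 2 * p → p ≤ 9 * n → casoratian (bFam 14 n) 7 ≠ 0 →
    (-12 : ℤ) ≤ padicValRat p (casoratian (bFam 14 n) 7)

/-- **Row3CellI** (`θ = p/n ∈ (9, 19/2]`, zero, casLB -13): `v_p(Cas₇) ≥ -11`; 2 exact instances, 0 violations. -/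
@[conjecture] def Row3CellI : Prop :=
  ∀ n p : ℕ, 2 ≤ n → p.Prime → 50 * n + 2 < p * p → 9 * n < p → 2 * p ≤ 19 * n → casoratian (bFam 14 n) 7 ≠ 0 →
    (-11 : ℤ) ≤ padicValRat p (casoratian (bFam 14 n) 7)

/-- **Row3CellJ** (`θ = p/n ∈ (19/2, 10]`, origin, casLB -13): `v_p(Cas₇) ≥ -12`; 1 exact instances, 0 violations. -/
@[conjecture] def Row3CellJ : Prop :=
  ∀ n p : ℕ, 2 ≤ n → p.Prime → 50 * n + 2 < p * p → 19 * n < 2 * p → p ≤ 10 * n → casoratian (bFam 14 n) 7 ≠ 0 →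
    (-12 : ℤ) ≤ padicValRat p (casoratian (bFam 14 n) 7)

/-- **Row3CellK** (`θ = p/n ∈ (10, 11]`, origin, casLB -15): `v_p(Cas₇) ≥ -14`; 3 exact instances, 0 violations. -/
@[conjecture] def Row3CellK : Prop :=
  ∀ n p : ℕ, 2 ≤ n → p.Prime → 50 * n + 2 < p * p → 10 * n < p → p ≤ 11 * n → casoratian (bFam 14 n) 7 ≠ 0 →
    (-14 : ℤ) ≤ padicValRat p (casoratian (bFam 14 n) 7)

/-- **Row3CellL** (`θ = p/n ∈ (11, 12]`, origin, casLB -13): `v_p(Cas₇) ≥ -12`; 2 exact instances, 0 violations. -/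
@[conjecture] def Row3CellL : Prop :=
  ∀ n p : ℕ, 2 ≤ n → p.Prime → 50 * n + 2 < p * p → 11 * n < p → p ≤ 12 * n → casoratian (bFam 14 n) 7 ≠ 0 →
    (-12 : ℤ) ≤ padicValRat p (casoratian (bFam 14 n) 7)

/-- **Row3CellM** (`θ = p/n ∈ (15, 31/2]`, affine, casLB -7): `v_p(Cas₇) ≥ -6`; 2 exact instances, 0 violations. -/
@[conjecture] def Row3CellM : Prop :=
  ∀ n p : ℕ, 2 ≤ n → p.Prime → 50 * n + 2 < p * p → 15 * n < p → 2 * p ≤ 31 * n → casoratian (bFam 14 n) 7 ≠ 0 →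
    (-6 : ℤ) ≤ padicValRat p (casoratian (bFam 14 n) 7)

/-- **Row3CellN** (`θ = p/n ∈ (17, 18]`, origin, casLB -5): `v_p(Cas₇) ≥ -4`; 2 exact instances, 0 violations. -/
@[conjecture] def Row3CellN : Prop :=
  ∀ n p : ℕ, 2 ≤ n → p.Prime → 50 * n + 2 < p * p → 17 * n < p → p ≤ 18 * n → casoratian (bFam 14 n) 7 ≠ 0 →
    (-4 : ℤ) ≤ padicValRat p (casoratian (bFam 14 n) 7)

end Summit.KontsevichZagierPeriods.Zeta5Search.RayAtlas
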